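import Mathlib.Analysis.Calculus.Deriv.MeanValue
import Mathlib.Analysis.SpecialFunctions.ExpDeriv
import Mathlib.Analysis.Complex.Exponential

/-!
# Line `beta-slope-floor` (crux `IR`, stmt-QuantumFields-19354): the slope floor in the SPECTRAL class — an amplitude zero defeats every correlator-level floor; the spectral floor is the gap itself

Lead prover `ym-ir-line-bsf-p1` (g4), on the line's XL load (`ReflSlopeFloor` v4–v5.1, guarded `ReflSlopeFloorPos` v6,
slice `SlopeFloor` v1–v3): `(c·a(b)·S − K_A)·R_b(A;S) ≤ ∂_b R_b(A;S)` on unit windows, for the (reflected antipodal /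
slice-diagonal) time correlator of a species `A`.  In transfer-matrix currency such a correlator is a spectral sum
`R_b(S) = Σ_j w_j(b) e^{−E_j(b)·S}` with levels `E_j(b) ≥ 0` and amplitudes `w_j(b)` (`= |⟨e_j, ÂΩ⟩|² ≥ 0` in the
reflection-positive parity).  This file records, kernel-checked in the abstract class, the two facts that settle the
line's typing:

* §1 `guardedFloor_fails_near_amplitudeZero` — AN AMPLITUDE ZERO DEFEATS THE FLOOR.  For the two-level clause
  `R(b,S) = κ(b − b⋆)² e^{−E₁(b)S} + γ e^{−E₂(b)S}` (`κ, γ > 0`; levels with slopes in `[−M, 0]` on `[b⋆ − 1, b⋆]` —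
  they may RUN, as asymptotic freedom wants —, `E₂ − E₁ ≥ Δ > 0` there), and for EVERY `c > 0`, `K`, `S₀`: some
  natural `S ≥ S₀` and some `b ∈ (b⋆ − 1, b⋆)` have `R(b,S) > 0` and `∂_b R(b,S) < 0 < (c·S − K)·R(b,S)` (take
  `b = b⋆ − θ/S`, `θ = 1/(M+1)`: the amplitude's decrease `−2κθ/S` beats the running `+κθ²|E₁′|/S` and the
  exponentially smaller second level).  So the guarded floor (asked only where `R > 0`; unit `a ≡ 1` on the window —
  a unit bounded below on the window only rescales `c`) FAILS for all large `S` at couplings just below an amplitude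
  zero, whatever `K_A`; a fortiori the unguarded floors fail.  Amplitude zeros in `[β₂, ∞)` are generic for the
  universally quantified species of the load (for two species `A₁, A₂` coupling to the lightest state, `A₁ − λA₂`
  decouples at any prescribed `b⋆` for a suitable real `λ`) — this instantiation is the one non-kernel step (standard
  transfer-matrix heuristics).  No guard repairs it without collapsing to the leaf: a control of `R_β(A)` immune to
  the zeros of `A`'s own amplitudes is by a species-independent quantity at `β+1`, i.e. by the trivial anchor, and is
  then the decay statement itself.
* §2 `gap_of_levelFloor` — THE SPECTRAL FLOOR IS THE GAP.  If a level `E` is differentiable on `[β, β+1]` with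
  `−E′ ≥ l₀` there and the FREE anchor `E(β+1) ≥ 0`, then `E(β) ≥ l₀`: the load re-typed on the lattice gap
  `E₁(b) = −log(λ₁/λ₀)(b)` ("the gap runs at rate `≥ c·a(b)`") integrates in one line to the gap in units
  `E₁(β) ≥ c·κ·a(β)` — the leaf's content — so in spectral currency the load is `leaf ∧ monotone running` (EQUIV⁺).

Consequence (lead's verdict, `Cruxes/IR/Lines/beta-slope-floor.dead.md`): the β-transport lever has no currency in
which it is both plausibly true and different from the leaf; the line is retired as a lever, its landed engine
(transport lemmas p587735/p589159/p589353/p613899, species ⇒ pairs p588079, strong-coupling rungs p594987/p598053/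
p613474, SCFloor parts 1–22) standing as group-blind library content.
HONEST: abstract real analysis; nothing here is a statement about Yang–Mills expectations; nothing here proves or
refutes `BalabanLadder.IR` or bears on the Clay Yang–Mills mass gap (R4 closes only `BalabanLadder.UV`).
-/

set_option autoImplicit false

noncomputable section

open Set Real

namespace Summit.QuantumFields.YangMills.Cruxes.IR.BetaSlopeFloor.SpectralClass

/-! ## §1 An amplitude zero defeats every correlator-level slope floor -/

/-- The `b`-derivative of the two-level clause `R(b,S) = κ(b − b⋆)² e^{−E₁(b)S} + γ e^{−E₂(b)S}` (amplitude zero at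
`b⋆`). -/
theorem hasDerivAt_twoLevel (κ γ bstar : ℝ) {E₁ E₂ : ℝ → ℝ} {E₁' E₂' : ℝ} (S : ℝ) {b : ℝ}
    (h₁ : HasDerivAt E₁ E₁' b) (h₂ : HasDerivAt E₂ E₂' b) :
    HasDerivAt (fun x => κ * (x - bstar) ^ 2 * exp (-(E₁ x * S)) + γ * exp (-(E₂ x * S)))
      (κ * (2 * (b - bstar)) * exp (-(E₁ b * S)) + κ * (b - bstar) ^ 2 * (exp (-(E₁ b * S)) * (-(E₁' * S))) +
        γ * (exp (-(E₂ b * S)) * (-(E₂' * S)))) b := by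
  have hsq : HasDerivAt (fun x : ℝ => (x - bstar) ^ 2) (2 * (b - bstar)) b := by
    have h1 : HasDerivAt (fun x : ℝ => x - bstar) 1 b := (hasDerivAt_id' b).sub_const bstar
    have h2 := h1.mul h1
    have hf : (fun x : ℝ => (x - bstar) ^ 2) = fun x => (x - bstar) * (x - bstar) := by
      funext x; ring
    rw [hf]
    exact h2.congr_deriv (by ring)
  have he₁ : HasDerivAt (fun x => exp (-(E₁ x * S))) (exp (-(E₁ b * S)) * (-(E₁' * S))) b :=
    (h₁.mul_const S).neg.exp
  have he₂ : HasDerivAt (fun x => exp (-(E₂ x * S))) (exp (-(E₂ b * S)) * (-(E₂' * S))) b :=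
    (h₂.mul_const S).neg.exp
  have h := ((hsq.const_mul κ).mul he₁).add (he₂.const_mul γ)
  exact h.congr_deriv (by ring)

/-- `A·S² ≤ e^{ΔS}` once `6A ≤ Δ³S` (`A, S ≥ 0`), from `x³/3! ≤ eˣ`. -/
theorem mul_sq_le_exp {A Δ S : ℝ} (hS : 0 ≤ S) (hΔ : 0 ≤ Δ) (h : 6 * A ≤ Δ ^ 3 * S) :
    A * S ^ 2 ≤ exp (Δ * S) := by
  have hcube : (Δ * S) ^ 3 / 6 ≤ exp (Δ * S) := by
    have := Real.pow_div_factorial_le_exp (x := Δ * S) (by positivity) 3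
    simpa [Nat.factorial] using this
  calc A * S ^ 2 = (6 * A) * S ^ 2 / 6 := by ring
    _ ≤ (Δ ^ 3 * S) * S ^ 2 / 6 := by gcongr
    _ = (Δ * S) ^ 3 / 6 := by ring
    _ ≤ exp (Δ * S) := hcube

/-- **An amplitude zero defeats the (guarded) slope floor.**  Two-level clause with `κ, γ > 0`; levels `E₁, E₂`
differentiable on `[b⋆ − 1, b⋆]` with slopes in `[−M, 0]` (`M ≥ 0`) and separated by `E₂ − E₁ ≥ Δ > 0` there.
Then for every `c > 0`, every `K` and every `S₀` there are a natural number `S ≥ S₀` and `b ∈ (b⋆ − 1, b⋆)` with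
`R(b,S) > 0`, `∂_b R(b,S) < 0` and hence `∂_b R(b,S) < (c·S − K)·R(b,S)`: the floor fails where the clause is
positive, for arbitrarily large `S`. -/
theorem guardedFloor_fails_near_amplitudeZero {κ γ bstar M Δ : ℝ} {E₁ E₂ E₁' E₂' : ℝ → ℝ}
    (hκ : 0 < κ) (hγ : 0 < γ) (hM : 0 ≤ M) (hΔ : 0 < Δ)
    (hE₁ : ∀ b ∈ Icc (bstar - 1) bstar, HasDerivAt E₁ (E₁' b) b ∧ -M ≤ E₁' b ∧ E₁' b ≤ 0)
    (hE₂ : ∀ b ∈ Icc (bstar - 1) bstar, HasDerivAt E₂ (E₂' b) b ∧ -M ≤ E₂' b ∧ E₂' b ≤ 0)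
    (hgap : ∀ b ∈ Icc (bstar - 1) bstar, Δ ≤ E₂ b - E₁ b)
    (c K S₀ : ℝ) (hc : 0 < c) :
    ∃ S : ℕ, S₀ ≤ S ∧ ∃ b ∈ Ioo (bstar - 1) bstar,
      0 < κ * (b - bstar) ^ 2 * exp (-(E₁ b * S)) + γ * exp (-(E₂ b * S)) ∧
        deriv (fun x => κ * (x - bstar) ^ 2 * exp (-(E₁ x * S)) + γ * exp (-(E₂ x * S))) b < 0 ∧
          deriv (fun x => κ * (x - bstar) ^ 2 * exp (-(E₁ x * S)) + γ * exp (-(E₂ x * S))) b <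
            (c * S - K) * (κ * (b - bstar) ^ 2 * exp (-(E₁ b * S)) + γ * exp (-(E₂ b * S))) := by
  -- the step `θ = 1/(M+1)` and the constant `A = γM/(κθ)`
  set θ : ℝ := 1 / (M + 1) with hθ
  have hθ0 : 0 < θ := by positivity
  have hθ1 : θ ≤ 1 := by rw [hθ, div_le_one (by positivity)]; linarith
  have hθM : θ * M ≤ 1 := by
    rw [hθ, one_div, inv_mul_le_iff₀ (by positivity)]; linarith
  set A : ℝ := γ * M / (κ * θ) with hA
  have hA0 : 0 ≤ A := by positivity
  have hκθA : κ * θ * A = γ * M := by rw [hA]; field_simp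
  -- choose a natural `S` above all thresholds
  obtain ⟨S, hS⟩ := exists_nat_gt (max (max S₀ (K / c)) (max (6 * (A + 1) / Δ ^ 3) 1))
  have hS₀ : S₀ ≤ (S : ℝ) := le_of_lt (lt_of_le_of_lt ((le_max_left _ _).trans (le_max_left _ _)) hS)
  have hSK : K / c < (S : ℝ) := lt_of_le_of_lt ((le_max_right _ _).trans (le_max_left _ _)) hS
  have hSA : 6 * (A + 1) / Δ ^ 3 < (S : ℝ) := lt_of_le_of_lt ((le_max_left _ _).trans (le_max_right _ _)) hS
  have hS1 : (1 : ℝ) < S := lt_of_le_of_lt ((le_max_right _ _).trans (le_max_right _ _)) hS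
  have hSpos : (0 : ℝ) < S := by linarith
  refine ⟨S, hS₀, ?_⟩
  -- the point `b = b⋆ − θ/S`
  set t : ℝ := θ / S with ht
  have ht0 : 0 < t := by positivity
  have ht1 : t < 1 := by
    rw [ht, div_lt_one hSpos]; linarith
  have htS : t * S = θ := by rw [ht]; field_simp
  set b : ℝ := bstar - t with hb
  have hbI : b ∈ Ioo (bstar - 1) bstar := ⟨by rw [hb]; linarith, by rw [hb]; linarith⟩
  have hbI' : b ∈ Icc (bstar - 1) bstar := Ioo_subset_Icc_self hbI
  refine ⟨b, hbI, ?_⟩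
  obtain ⟨hd₁, hE₁lo, hE₁hi⟩ := hE₁ b hbI'
  obtain ⟨hd₂, hE₂lo, hE₂hi⟩ := hE₂ b hbI'
  have hgapb := hgap b hbI'
  have hder := hasDerivAt_twoLevel κ γ bstar (S := (S : ℝ)) hd₁ hd₂
  rw [hder.deriv]
  have hbb : b - bstar = -t := by rw [hb]; ring
  -- abbreviations for the two Boltzmann factors
  set e₁ : ℝ := exp (-(E₁ b * S)) with he₁
  set e₂ : ℝ := exp (-(E₂ b * S)) with he₂
  have he₁0 : 0 < e₁ := exp_pos _
  have he₂0 : 0 < e₂ := exp_pos _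
  -- positivity of the clause
  have hRpos : 0 < κ * (b - bstar) ^ 2 * e₁ + γ * e₂ := by
    have h1 : 0 ≤ κ * (b - bstar) ^ 2 * e₁ := by positivity
    have h2 : 0 < γ * e₂ := mul_pos hγ he₂0
    linarith
  -- (1) the running of the first level cannot undo the amplitude's decrease: `κ t² e₁ (−E₁′) S ≤ κ t e₁`
  have hterm1 : κ * t ^ 2 * e₁ * (-E₁' b) * S ≤ κ * t * e₁ := by
    have h1 : κ * t ^ 2 * e₁ * (-E₁' b) * S = κ * t * e₁ * (θ * (-E₁' b)) := by
      rw [← htS]; ring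
    rw [h1]
    have h2 : θ * (-E₁' b) ≤ 1 := le_trans (mul_le_mul_of_nonneg_left (by linarith) hθ0.le) hθM
    have h3 : 0 ≤ κ * t * e₁ := by positivity
    calc κ * t * e₁ * (θ * (-E₁' b)) ≤ κ * t * e₁ * 1 := mul_le_mul_of_nonneg_left h2 h3
      _ = κ * t * e₁ := mul_one _
  -- (2) the second level's running is at most `γ e₂ M S`
  have hterm2 : γ * e₂ * (-E₂' b) * S ≤ γ * e₂ * M * S := by
    have h1 : 0 ≤ γ * e₂ * S := by positivity
    have h2 : -E₂' b ≤ M := by linarith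
    calc γ * e₂ * (-E₂' b) * S = γ * e₂ * S * (-E₂' b) := by ring
      _ ≤ γ * e₂ * S * M := mul_le_mul_of_nonneg_left h2 h1
      _ = γ * e₂ * M * S := by ring
  -- (3) and that is exponentially smaller than the amplitude's decrease: `γ e₂ M S < κ t e₁`
  have hterm3 : γ * e₂ * M * S < κ * t * e₁ := by
    -- `e₂ ≤ e₁ e^{−ΔS}`
    have h12 : e₂ ≤ e₁ * exp (-(Δ * S)) := by
      rw [he₁, he₂, ← exp_add]
      refine exp_le_exp.2 ?_
      nlinarith [mul_le_mul_of_nonneg_right hgapb hSpos.le]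
    -- `(A+1) S² ≤ e^{ΔS}`, hence `A S² e^{−ΔS} < 1`
    have h6 : 6 * (A + 1) ≤ Δ ^ 3 * S := by
      rw [div_lt_iff₀ (by positivity)] at hSA; linarith
    have hexpS : (A + 1) * (S : ℝ) ^ 2 ≤ exp (Δ * S) := mul_sq_le_exp hSpos.le hΔ.le h6
    have hAS : A * (S : ℝ) ^ 2 * exp (-(Δ * S)) < 1 := by
      rw [Real.exp_neg, ← div_eq_mul_inv, div_lt_one (exp_pos _)]
      have hS2 : 0 < (S : ℝ) ^ 2 := by positivity
      have : A * (S : ℝ) ^ 2 < (A + 1) * (S : ℝ) ^ 2 := by linarith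
      exact this.trans_le hexpS
    -- `γ M S² e₂ ≤ γ M S² e₁ e^{−ΔS} = κθ · (A S² e^{−ΔS}) · e₁ < κ θ e₁`
    have hmain : γ * e₂ * M * S * S < κ * θ * e₁ := by
      have h0 : 0 ≤ γ * M * S * S := by positivity
      have h1 : γ * e₂ * M * S * S ≤ γ * M * S * S * (e₁ * exp (-(Δ * S))) := by
        calc γ * e₂ * M * S * S = γ * M * S * S * e₂ := by ring
          _ ≤ γ * M * S * S * (e₁ * exp (-(Δ * S))) := mul_le_mul_of_nonneg_left h12 h0
      have h2 : γ * M * S * S * (e₁ * exp (-(Δ * S))) = κ * θ * e₁ * (A * (S : ℝ) ^ 2 * exp (-(Δ * S))) := by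
        rw [← hκθA]; ring
      have h3 : κ * θ * e₁ * (A * (S : ℝ) ^ 2 * exp (-(Δ * S))) < κ * θ * e₁ * 1 :=
        mul_lt_mul_of_pos_left hAS (by positivity)
      rw [h2] at h1
      linarith
    -- divide by `S`: `κ t e₁ = κ θ e₁ / S`
    have h4 : κ * t * e₁ = κ * θ * e₁ / S := by rw [ht]; field_simp
    rw [h4, lt_div_iff₀ hSpos]
    exact hmain
  -- the derivative is negative
  have hderiv_neg : κ * (2 * (b - bstar)) * e₁ + κ * (b - bstar) ^ 2 * (e₁ * (-(E₁' b * S))) +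
      γ * (e₂ * (-(E₂' b * S))) < 0 := by
    have hexpand : κ * (2 * (b - bstar)) * e₁ + κ * (b - bstar) ^ 2 * (e₁ * (-(E₁' b * S))) +
        γ * (e₂ * (-(E₂' b * S))) =
        -(2 * (κ * t * e₁)) + κ * t ^ 2 * e₁ * (-E₁' b) * S + γ * e₂ * (-E₂' b) * S := by
      rw [hbb]; ring
    rw [hexpand]
    linarith
  refine ⟨hRpos, hderiv_neg, lt_of_lt_of_le hderiv_neg ?_⟩
  -- `(c S − K) R ≥ 0`
  have hcS : 0 ≤ c * (S : ℝ) - K := by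
    have h1 : K < (S : ℝ) * c := (div_lt_iff₀ hc).1 hSK
    linarith
  exact mul_nonneg hcS hRpos.le

/-! ## §2 In spectral currency the floor integrates to the gap from the free anchor -/

/-- **The spectral slope floor is the gap.**  If `E` is differentiable on `[β, β+1]` with `l₀ ≤ −E′` there and the
free anchor `0 ≤ E(β+1)` holds, then `l₀ ≤ E(β)`.  (With `E = E₁(b) = −log(λ₁/λ₀)(b)` the lattice gap, always
`≥ 0`, and `l₀ = c·κ·a(β)` the running floor frozen by window regularity, this is the gap in units at `β`.) -/
theorem gap_of_levelFloor {E : ℝ → ℝ} {β l₀ : ℝ} (hE : ∀ x ∈ Icc β (β + 1), DifferentiableAt ℝ E x)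
    (hfl : ∀ x ∈ Icc β (β + 1), l₀ ≤ -deriv E x) (h0 : 0 ≤ E (β + 1)) : l₀ ≤ E β := by
  have hcont : ContinuousOn E (Icc β (β + 1)) := fun x hx => (hE x hx).continuousAt.continuousWithinAt
  have hdiff : DifferentiableOn ℝ E (interior (Icc β (β + 1))) := by
    rw [interior_Icc]; exact fun x hx => (hE x (Ioo_subset_Icc_self hx)).differentiableWithinAt
  have hle : ∀ x ∈ interior (Icc β (β + 1)), deriv E x ≤ -l₀ := by
    rw [interior_Icc]; intro x hx; have := hfl x (Ioo_subset_Icc_self hx); linarith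
  have h := (convex_Icc β (β + 1)).image_sub_le_mul_sub_of_deriv_le hcont hdiff hle β
    ⟨le_rfl, by linarith⟩ (β + 1) ⟨by linarith, le_rfl⟩ (by linarith)
  linarith

/-- The same with a running floor `l(x) ≥ l₀` (the load's shape `−E′(b) ≥ c·a(b)` with `c·a(b) ≥ c·κ·a(β)` on the
window): `E(β) ≥ l₀`. -/
theorem gap_of_runningLevelFloor {E l : ℝ → ℝ} {β l₀ : ℝ} (hE : ∀ x ∈ Icc β (β + 1), DifferentiableAt ℝ E x)
    (hfl : ∀ x ∈ Icc β (β + 1), l x ≤ -deriv E x) (hl₀ : ∀ x ∈ Icc β (β + 1), l₀ ≤ l x)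
    (h0 : 0 ≤ E (β + 1)) : l₀ ≤ E β :=
  gap_of_levelFloor hE (fun x hx => (hl₀ x hx).trans (hfl x hx)) h0

/-! ## §3 The load's quantifier shape is refuted in the abstract class -/

/-- **The quantifier shape of the load fails in the abstract class.**  Let `R A S b` be any assignment of clauses to
an index type of "species", and `a` a unit bounded below by `a₀ > 0`.  If beyond every threshold some species' clause is
a two-level clause with an amplitude zero at some `b⋆` (hypotheses of `guardedFloor_fails_near_amplitudeZero` on
`[b⋆ − 1, b⋆]`, `b⋆ > β₂ + 1`), then the GUARDED running floor with the load's quantifier shape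
`∃ c>0, β₂, S₁; ∀ A ∃ K; ∀ β ≥ β₂, S ≥ S₁ β, b ∈ [β, β+1]: (0 < R → (c·a(b)·S − K)·R ≤ ∂_b R)` is FALSE. -/
theorem floorShape_fails_of_amplitudeZeros {ι : Type*} (R : ι → ℝ → ℝ → ℝ) (a : ℝ → ℝ) {a₀ : ℝ} (ha₀ : 0 < a₀)
    (ha : ∀ b, a₀ ≤ a b)
    (hzero : ∀ β₂ : ℝ, ∃ (A : ι) (κ γ bstar M Δ : ℝ) (E₁ E₂ E₁' E₂' : ℝ → ℝ),
      β₂ + 1 < bstar ∧ 0 < κ ∧ 0 < γ ∧ 0 ≤ M ∧ 0 < Δ ∧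
      (∀ b ∈ Icc (bstar - 1) bstar, HasDerivAt E₁ (E₁' b) b ∧ -M ≤ E₁' b ∧ E₁' b ≤ 0) ∧
      (∀ b ∈ Icc (bstar - 1) bstar, HasDerivAt E₂ (E₂' b) b ∧ -M ≤ E₂' b ∧ E₂' b ≤ 0) ∧
      (∀ b ∈ Icc (bstar - 1) bstar, Δ ≤ E₂ b - E₁ b) ∧
      ∀ (S : ℝ) (b : ℝ), R A S b = κ * (b - bstar) ^ 2 * exp (-(E₁ b * S)) + γ * exp (-(E₂ b * S))) :
    ¬ ∃ (c β₂ : ℝ) (S₁ : ℝ → ℕ), 0 < c ∧ ∀ A : ι, ∃ K : ℝ, ∀ β : ℝ, β₂ ≤ β → ∀ S : ℕ, S₁ β ≤ S →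
        ∀ b : ℝ, β ≤ b → b ≤ β + 1 →
          (0 < R A S b → (c * a b * S - K) * R A S b ≤ deriv (fun b' => R A S b') b) := by
  rintro ⟨c, β₂, S₁, hc, hfl⟩
  obtain ⟨A, κ, γ, bstar, M, Δ, E₁, E₂, E₁', E₂', hb, hκ, hγ, hM, hΔ, hE₁, hE₂, hgap, hR⟩ := hzero β₂
  obtain ⟨K, hK⟩ := hfl A
  -- the window `[b⋆ − 1, b⋆]`, with `β = b⋆ − 1 ≥ β₂`
  have hβ : β₂ ≤ bstar - 1 := by linarith
  obtain ⟨S, hS, b, hbI, hRpos, hneg, -⟩ :=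
    guardedFloor_fails_near_amplitudeZero hκ hγ hM hΔ hE₁ hE₂ hgap (c * a₀) K
      (max (S₁ (bstar - 1) : ℝ) (K / (c * a₀))) (mul_pos hc ha₀)
  have hS₁ : S₁ (bstar - 1) ≤ S := by
    have : (S₁ (bstar - 1) : ℝ) ≤ S := (le_max_left _ _).trans hS
    exact_mod_cast this
  have hSK : K / (c * a₀) ≤ (S : ℝ) := (le_max_right _ _).trans hS
  have hfun : (fun b' => R A S b') = fun b' => κ * (b' - bstar) ^ 2 * exp (-(E₁ b' * S)) + γ * exp (-(E₂ b' * S)) := by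
    funext b'; exact hR S b'
  have h := hK (bstar - 1) hβ S hS₁ b hbI.1.le (by linarith [hbI.2])
  rw [hR S b, hfun] at h
  have h1 := h hRpos
  -- `(c a(b) S − K) ≥ (c a₀ S − K) ≥ 0`, so the floor's left side is `≥ 0 > ∂_b R`
  have hcoef : 0 ≤ c * a b * S - K := by
    have h2 : K ≤ c * a₀ * S := by rwa [div_le_iff₀ (mul_pos hc ha₀), mul_comm] at hSK
    have h3 : c * a₀ * S ≤ c * a b * S :=
      mul_le_mul_of_nonneg_right (mul_le_mul_of_nonneg_left (ha b) hc.le) (Nat.cast_nonneg S)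
    linarith
  have h4 : 0 ≤ (c * a b * S - K) * (κ * (b - bstar) ^ 2 * exp (-(E₁ b * S)) + γ * exp (-(E₂ b * S))) :=
    mul_nonneg hcoef hRpos.le
  linarith

end Summit.QuantumFields.YangMills.Cruxes.IR.BetaSlopeFloor.SpectralClass

end
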